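import Summits.QuantumFields.YangMills.Theorems.BalabanUVNodesN18HLayerW1ConfigRecord

/-!
# BalabanUVNodes ∕ N18 — LEMMA 3 AT W1's OBJECTS IN THE CONFIGURATION DIRECTION: [II] (2.26) per term (or in resummed form) ON A SPACE TABLE ⟹
# W1's `ClusterStep.Bound238` ((2.38)) by the kernel-checked torus resummation `B13Lemma3TorusSocket` BY NAME; composed with files 9–10: PRINT's OWN
# ROUTE «(2.26) at real couplings + analyticity in (𝐔,𝐉) ⟹ (2.38) ⟹ (2.41) = (1.18) for k+1» at the objects of record, on any table
# (Track A, DAG node N18 = NE5 `T4OutputRate.NE5 EA EB W κ θ C₅` :211; cluster K4 «SpineRates»; file 12 of seat pub-ymgap-dag-n18-c, row s1,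
# generation 3; the producer of the `h238` hypothesis of files 9 `…N18HLayerW1Config` p470180 ∕ 10 `…N18HLayerW1ConfigRecord` p474817)

Cell `pub-ymgap`, HUMAN RULING D-0062 (Track A), R134 ACCELERATION seat `pub-ymgap-dag-n18-c` (strategy s1), generation 3.  THEOREMS ONLY (no `def`,
no `instance`, no `sorry`); imports file 10 (through it file 9, n22-c's strip modules and their import `B13Lemma3TorusSocket` p-balaban, W1's
`Node00/HistoryTermsOfRecord` ∕ `RateRecordW1Reading`); restates nothing.

WHY.  Files 9–10 take, per step, W1's named (2.38) `ClusterStep.Bound238 Wk sp A R` as a hypothesis.  Print PROVES (2.38) (Lemma 3 p. 20) from the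
TERMWISE bounds (2.26) p. 17 by the resummation (2.28)–(2.37) — kernel-checked in the tree on the papers' periodic carrier (`B13Lemma3Torus.bound238With_torus`)
and packaged as the SOCKET `B13Lemma3TorusSocket` (LEVEL T: `TermDomination` + `Termwise226` ⟹ LEVEL R: `HRep` ⟹ `B13.Bound238With … (½L)`, the 25
printed restrictions bundled ONCE as `Lemma3Numerics`, (2.36) discharged at `ℓ = ½L`, `L ≥ 8`).  n22-c ran the socket on the COUPLING STRIP (`Φ := ℂ`,
`…N22W1StripLemma3.strip_succ_of_stripStepHRep`).  THIS FILE runs it IN THE CONFIGURATION DIRECTION — print's own: at real young couplings `g`, the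
two-torus step with configuration type `Φ := Sect2.CPair (F.P K) 𝔸` itself, space `sp2 := sp` (the W1 table at step `k+1`), activity
`H Z φ := (S k).H g φ Z`, every other field inert — so that the socket's output IS `ClusterStep.Bound238 Wk sp (C₃ε₁) ((1−8δ)½Lκ)` (by `rfl` on the
letters).  Composed with file 10 (any table, no openness) this is PRINT's ROUTE to «the inductive assumption (1.18) for k+1» ([II] p. 21–22) AT THE
OBJECTS OF RECORD: (2.26) per term at real couplings on the space + (2.13an) in `(𝐔,𝐉)` ⟹ (2.38) ⟹ (2.41), modulo exactly the per-term (2.26) data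
(N10's Lemmas 1–2 ∕ NODE A's majorant on the class (1.5) — `B13Lemma3TorusPrimitive.h226_torus_of_primitives` supplies it per term from the
primitive data) and the printed numerics.

WHAT (theorems only; coefficient algebra `𝔸 : Type` — the socket's `TwoTorusStep.Φ` lives in `Type`; the record's `M_N(ℂ)` qualifies).
* §0 `analyticH_of_analyticT` — the analytic half from termwise data: W1's `AnalyticT` ((2.14) termwise analytic on the space) ⟹ `AnalyticH` (finite sum).
* §1 `bound238_of_hRep_config` — LEVEL R: for `S : W1.ClusterStep (F.P K) 𝔸 M k`, a young-coupling set `Wk`, ANY table `sp`: the resummed (2.26)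
  inequality `HRep c M a a₅` of the configuration step at every `g ∈ Wk` + `Lemma3Numerics c M (½L) …` + `8 ≤ L` ⟹
  `S.Bound238 Wk sp (c.C3act·c.ε₁) ((1 − 8c.δ)·(c.L∕2)·c.κ)` (`h238_of_hRep_half` BY NAME).
* §2 `bound238_of_termwise226_config` — LEVEL T: termwise domination `‖S.H g φ Z‖ ≤ Σ_{t ∈ terms L M Z} ‖T g Z t φ‖` ((2.9)∕(2.14)) and (2.26) per term
  `‖T g Z t φ‖ ≤ weight(t)·e^{a₅|Z|}` on the table, for term maps `T g Z t : Φ → ℂ` over the socket's torus term catalogue `B13Lemma3TorusTerms.terms L M Z`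
  ⟹ the same `Bound238` (`hRep_of_termwise` ∘ §1).
* §3 END TO END WITH FILE 10 (any restriction-closed table, e.g. `W1.spaceOfRecord`): `termBound118_of_termwise226_config` ∕
  `termAnalytic_of_termwise226_config` — per-step (2.26) data on the table + `AnalyticH` + `SpRestr` + `Lemma3Numerics` + the located rate clause
  `r₁ + 2·64·log 162 + 2 ≤ (1−8δ)½Lκ` + the STRICT [KP86] clause `C₃ε₁·e^{5r₁+1}·K₀(64,8)·9·64 < 1` ⟹ `W1.TermBound118 S W sp (e·9·64·K₀(64,8)²·C₃ε₁) r₁`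
  and `W1.TermAnalytic S W sp`; `decayBound_EA_of_termwise226_config` — L05 at the W1 reading's level pairing likewise.

HONEST FRAMING — what this is NOT.  Count-neutral by-name knit (Lemma 3's resummation is the tree's theorem; [KP86] and [Chae1985] through files 9–10);
NOT a discharge of N18 (typed 28∕28 · discharged 5∕27 UNCHANGED).  The per-term data (`hdom`, `h226`) are DISPLAYED: they are [II] (2.9)∕(2.14) (H is
the sum of its (𝐃,P)-terms — for typed objects `B13Representation214.H28_sum_eq_sum_term214`) and (2.26) p. 17 for THE terms of record — N10's Lemmas
1–2 + NODE A's majorant; the term maps `T` over the socket's catalogue `terms L M Z` on the fine torus `tsys 4 (L·N′)`, `N′ = domCount (F.P K) M (k+1)`,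
are data (the identification of W1's abstract index `S.Idx` with it is the caller's); `AnalyticH`, `SpRestr`, the readings in the spaces and the
numerics are displayed as in files 9–10.  NE5 (the η-rate) untouched; NOT IN PRINT, NOT PROVED.  One finite four-torus programme at fixed `ε`, Bałaban
as printed — NOT the continuum limit on ℝ⁴, NOT infinite volume, NOT OS, NOT a mass gap, NOT Clay.  0 `sorry`, 0 `def`; axioms standard.

References (TYPES ∕ loci only): [II] = [Balaban1988RG2Cluster] CMP **116** (1988) — (2.9) p. 14, (2.14) p. 15, the analyticity statement p. 15, (2.26)
p. 17, (2.28)–(2.37) pp. 17–20, Lemma 3 (2.38) p. 20, (2.39)–(2.41) p. 21, p. 21–22; [I] = [Balaban1987RG1] CMP **109** (1987) — (1.18) p. 263;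
[KoteckyPreiss1986] Thm p. 492.
-/

noncomputable section

namespace Summit.QuantumFields.YangMills.BalabanUVNodes.N18HLayerW1Lemma3Config

open Set Metric
open scoped BigOperators
open Literature.MathematicalPhysics.QuantumFieldTheory.Balaban1983to89
open Literature.MathematicalPhysics.QuantumFieldTheory.Balaban1983to89.T4Continuum (T4Family)
open Literature.MathematicalPhysics.QuantumFieldTheory.Balaban1983to89.T4OutputRate
open Literature.MathematicalPhysics.QuantumFieldTheory.Balaban1983to89.TreeLengthTorus (TPt TDom tsys torusTreeLen)
open Literature.MathematicalPhysics.QuantumFieldTheory.Balaban1983to89.TreeLengthTorusTransfer (tclosureDom)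
open Literature.MathematicalPhysics.QuantumFieldTheory.Balaban1983to89.B12TreeDecay (K₀)
open Literature.MathematicalPhysics.QuantumFieldTheory.Balaban1983to89.B13Lemma3TorusData (TBond ttouch tavail)
open Literature.MathematicalPhysics.QuantumFieldTheory.Balaban1983to89.B13Lemma3Assembly (innerSum compSum famSum)
open Literature.MathematicalPhysics.QuantumFieldTheory.Balaban1983to89.B13Lemma3Torus (TwoTorusStep J I wZ cc)
open Literature.MathematicalPhysics.QuantumFieldTheory.Balaban1983to89.B13Lemma3TorusTerms (terms weight)
open Literature.MathematicalPhysics.QuantumFieldTheory.Balaban1983to89.B13Lemma3TorusSocket (HRep Lemma3Numerics h238_of_hRep_half hRep_of_termwise)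
open Literature.MathematicalPhysics.QuantumFieldTheory.Balaban1983to89.Node00
open Literature.MathematicalPhysics.QuantumFieldTheory.Balaban1983to89.Node00.Sect2 (domSys domCount CPair)
open Literature.MathematicalPhysics.QuantumFieldTheory.Balaban1983to89.Node00.W1
open Summit.QuantumFields.YangMills.BalabanUVNodes.N18HLayerW1ConfigRecord

variable (F : T4Family) (K : ℕ) {𝔸 : Type} [NormedRing 𝔸] [NormedAlgebra ℂ 𝔸] {M : ℕ} [NeZero M]

/-! ## §0 LEVEL T for analyticity: (2.14) termwise analytic on the space ⟹ (2.13an) for the activity (finite sum) -/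

omit [NeZero M] in
/-- **(2.14) TERMWISE ANALYTICITY ⟹ (2.13an) FOR THE ACTIVITY** ([II] p. 15: each term «an analytic function of (𝐔,𝐉) in the space U^c_{k+1}(X, α₀, α₁)»,
and `H(Z)` is the FINITE sum (2.9)∕(2.11) of its terms): W1's `ClusterStep.AnalyticT Wk sp` gives `ClusterStep.AnalyticH Wk sp` (any torus `P`, any
table) — the analytic half of the H-layer datum of files 9–10 from termwise data, as §2 gives the (2.38) half. [cite: Balaban1988RG2Cluster, (2.14) p.15 and p.15 (analyticity statement)] -/
theorem analyticH_of_analyticT {P : Params} {k : ℕ} (S : ClusterStep P 𝔸 M k) (Wk : Set (Fin (k + 1) → ℝ))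
    (sp : (domSys P M (k + 1)).Dom → Set (CPair P 𝔸)) (hT : S.AnalyticT Wk sp) : S.AnalyticH Wk sp :=
  fun g hg Z => by
    have h := Finset.analyticOnNhd_sum (S.idx Z) (f := fun i φ => S.T i g φ) fun i hi => hT g hg Z i hi
    rw [Finset.sum_fn] at h
    simpa only [ClusterStep.H] using h

/-! ## §1 LEVEL R: the resummed (2.26) inequality of the CONFIGURATION STEP ⟹ W1's `Bound238` (Lemma 3 by the socket) -/

omit [NormedRing 𝔸] [NormedAlgebra ℂ 𝔸] in
open Classical in
/-- **LEMMA 3 AT W1's ONE-STEP DATA, IN THE CONFIGURATION DIRECTION (LEVEL R).**  For W1's one-step data `S` at step `k` on the record's torus `F.P K`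
(`𝐃_{k+1} = tsys 4 N′`, `N′ = domCount (F.P K) M (k+1)`), a young-coupling set `Wk` and ANY space table `sp`: IF at every `g ∈ Wk` the CONFIGURATION
STEP — the socket's two-torus step with configuration type `Φ := CPair (F.P K) 𝔸`, space `sp2 := sp`, activity `H Z φ := S.H g φ Z`, every other
field inert (Lemma 3 reads none of them) — satisfies the resummed (2.26) inequality `HRep c M a a₅` ((2.26) p. 17 summed in the printed order over the
torus index sets of `B13Lemma3Torus`; DISPLAYED), and the printed restrictions on the constants hold (`Lemma3Numerics c M (½L) …`, `8 ≤ L`), THEN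
(2.38): `S.Bound238 Wk sp (C₃ε₁) ((1 − 8δ)·½L·κ)` — `B13Lemma3TorusSocket.h238_of_hRep_half` (Lemma 3's resummation pp. 17–20 + (2.36) at `ℓ = ½L`,
kernel-checked) BY NAME, its output read as W1's predicate by `rfl`. [cite: Balaban1988RG2Cluster, Lemma 3 (2.38) p.20] -/
theorem bound238_of_hRep_config {k : ℕ} (S : ClusterStep (F.P K) 𝔸 M k) (Wk : Set (Fin (k + 1) → ℝ))
    (sp : (domSys (F.P K) M (k + 1)).Dom → Set (CPair (F.P K) 𝔸)) (c : B13.Consts) {L : ℕ} [NeZero L] (hL : 8 ≤ c.L)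
    (hLc : c.L = L) {a a₂ a₂' a₅ Aabs : ℝ} (hN : Lemma3Numerics c M ((c.L : ℝ) / 2) a a₂ a₂' a₅ Aabs)
    (hrep : ∀ g ∈ Wk, HRep c M a a₅
      ({ volk := fun _ => 0, Φ := CPair (F.P K) 𝔸, Bond := PUnit, sp1 := fun _ => ∅, sp2 := sp,
         Bv := fun _ _ => 0, Vp := fun _ _ => 0, V := fun _ _ => 0, Q := fun _ _ _ _ => 0, Vpp := fun _ _ => 0,
         H := fun Z φ => S.H g φ Z, Ek1 := fun _ _ => 0, Elog := fun _ _ => 0, Analytic := fun _ _ => True,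
         GaugeInv := fun _ => True, Repr17 := True, Restr := True } : TwoTorusStep 4 L (domCount (F.P K) M (k + 1)))) :
    S.Bound238 Wk sp (c.C3act * c.ε₁) ((1 - 8 * c.δ) * ((c.L : ℝ) / 2) * c.κ) := by
  intro g hg Z φ hφ
  -- the socket at the configuration step (a constant family over a dummy index; the step is read off the type of `hrep g hg`)
  have h238 := h238_of_hRep_half c hL hLc (N' := fun _ : ℕ => domCount (F.P K) M (k + 1)) (fun _ => _) M hN
    (fun _ => hrep g hg) 0
  exact h238 Z φ hφ

/-! ## §2 LEVEL T: termwise domination + (2.26) per term on the table ⟹ W1's `Bound238` -/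

omit [NormedRing 𝔸] [NormedAlgebra ℂ 𝔸] in
open Classical in
/-- **LEMMA 3 AT W1's ONE-STEP DATA FROM (2.26) PER TERM (LEVEL T).**  With term maps `T g Z t : Φ → ℂ` over the socket's torus term catalogue
`terms L M Z` ((𝐃, P) with `Z′₀ ⊆ Z` on the fine torus `tsys 4 (L·N′)`): termwise domination on the table (`hdom`: `‖S.H g φ Z‖ ≤ Σ_t ‖T g Z t φ‖`,
[II] (2.9)∕(2.14) — «H(Z) is the sum of its terms») and (2.26) per term on the table (`h226`: `‖T g Z t φ‖ ≤ weight(t)·e^{a₅|Z|}` with the printed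
weights `B13Lemma3TorusTerms.weight`) at every `g ∈ Wk` + the numerics ⟹ `S.Bound238 Wk sp (C₃ε₁) ((1 − 8δ)·½L·κ)` (`hRep_of_termwise` ∘ §1).
[cite: Balaban1988RG2Cluster, (2.26) p.17 and Lemma 3 (2.38) p.20] -/
theorem bound238_of_termwise226_config {k : ℕ} (S : ClusterStep (F.P K) 𝔸 M k) (Wk : Set (Fin (k + 1) → ℝ))
    (sp : (domSys (F.P K) M (k + 1)).Dom → Set (CPair (F.P K) 𝔸)) (c : B13.Consts) {L : ℕ} [NeZero L] (hL : 8 ≤ c.L)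
    (hLc : c.L = L) {a a₂ a₂' a₅ Aabs : ℝ} (hN : Lemma3Numerics c M ((c.L : ℝ) / 2) a a₂ a₂' a₅ Aabs)
    (T : (Fin (k + 1) → ℝ) → (Z : TDom 4 (domCount (F.P K) M (k + 1))) →
      Finset (TDom 4 (L * domCount (F.P K) M (k + 1))) × Finset (TBond 4 M (L * domCount (F.P K) M (k + 1))) → CPair (F.P K) 𝔸 → ℂ)
    (hdom : ∀ g ∈ Wk, ∀ (Z : (domSys (F.P K) M (k + 1)).Dom) (φ : CPair (F.P K) 𝔸), φ ∈ sp Z →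
      ‖S.H g φ Z‖ ≤ ∑ t ∈ terms L M Z, ‖T g Z t φ‖)
    (h226 : ∀ g ∈ Wk, ∀ (Z : (domSys (F.P K) M (k + 1)).Dom) (φ : CPair (F.P K) 𝔸), φ ∈ sp Z → ∀ t ∈ terms L M Z,
      ‖T g Z t φ‖ ≤ weight L M c Z a t * Real.exp (a₅ * ((Z.1).card : ℝ))) :
    S.Bound238 Wk sp (c.C3act * c.ε₁) ((1 - 8 * c.δ) * ((c.L : ℝ) / 2) * c.κ) :=
  bound238_of_hRep_config F K S Wk sp c hL hLc hN fun g hg =>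
    hRep_of_termwise c (mul_nonneg hN.hα₆.le hN.hε₀) _ (T g) (hdom g hg) (h226 g hg)

/-! ## §3 END TO END WITH FILE 10: (2.26) per term + (2.13an) on a restriction-closed table ⟹ (1.18) and [I] p. 263 analyticity, any table -/

open Classical in
/-- **PRINT's ROUTE TO «THE INDUCTIVE ASSUMPTION (1.18) FOR k+1» AT THE OBJECTS OF RECORD, ANY RESTRICTION-CLOSED TABLE** ([II] p. 21–22).  For W1's tower
`S` on `F.P K`, a history set `W` with prefixes in `Wk k`, a table `sp` with the restriction property at every positive level: per step, term maps `T k`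
with termwise domination and (2.26) per term on the table (§2's `hdom`, `h226`), the activities analytic at the points of the spaces (`AnalyticH`), ONE
numerics bundle `Lemma3Numerics c M (½L) …` (`8 ≤ L`), the located rate clause `r₁ + 2·64·log 162 + 2 ≤ (1−8δ)½Lκ` and the STRICT [KP86] clause
`C₃ε₁·e^{5r₁+1}·K₀(64,8)·9·64 < 1` ⟹ `W1.TermBound118 S W sp (e·9·64·K₀(64,8)²·C₃ε₁) r₁` — §2 feeds file 10's `termBound118_of_bound238_table`.
[cite: Balaban1988RG2Cluster, (2.26) p.17, Lemma 3 (2.38) p.20 and (2.39)-(2.41) p.21; Balaban1987RG1, (1.18) p.263] -/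
theorem termBound118_of_termwise226_config (S : ClusterTower (F.P K) 𝔸 M) (W : Set (ℕ → ℝ)) (Wk : (k : ℕ) → Set (Fin (k + 1) → ℝ))
    (sp : (j : ℕ) → (domSys (F.P K) M j).Dom → Set (CPair (F.P K) 𝔸)) (c : B13.Consts) {L : ℕ} [NeZero L] (hL : 8 ≤ c.L)
    (hLc : c.L = L) {a a₂ a₂' a₅ Aabs : ℝ} (hN : Lemma3Numerics c M ((c.L : ℝ) / 2) a a₂ a₂' a₅ Aabs)
    (T : (k : ℕ) → (Fin (k + 1) → ℝ) → (Z : TDom 4 (domCount (F.P K) M (k + 1))) →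
      Finset (TDom 4 (L * domCount (F.P K) M (k + 1))) × Finset (TBond 4 M (L * domCount (F.P K) M (k + 1))) → CPair (F.P K) 𝔸 → ℂ)
    (hdom : ∀ k, ∀ g ∈ Wk k, ∀ (Z : (domSys (F.P K) M (k + 1)).Dom) (φ : CPair (F.P K) 𝔸), φ ∈ sp (k + 1) Z →
      ‖(S k).H g φ Z‖ ≤ ∑ t ∈ terms L M Z, ‖T k g Z t φ‖)
    (h226 : ∀ k, ∀ g ∈ Wk k, ∀ (Z : (domSys (F.P K) M (k + 1)).Dom) (φ : CPair (F.P K) 𝔸), φ ∈ sp (k + 1) Z → ∀ t ∈ terms L M Z,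
      ‖T k g Z t φ‖ ≤ weight L M c Z a t * Real.exp (a₅ * ((Z.1).card : ℝ)))
    (hW : ∀ k, ∀ g ∈ W, restrictPrefix k g ∈ Wk k) (hrestr : ∀ k, W1.SpRestr (sp (k + 1)))
    (han : ∀ k, (S k).AnalyticH (Wk k) (sp (k + 1))) {r₁ : ℝ} (hr₁ : 0 ≤ r₁) (hA : 0 ≤ c.C3act * c.ε₁)
    (hrate : r₁ + 2 * (64 * Real.log 162) + 2 ≤ (1 - 8 * c.δ) * ((c.L : ℝ) / 2) * c.κ)
    (hsmall : c.C3act * c.ε₁ * Real.exp (5 * r₁ + 1) * K₀ 64 8 * 9 * 64 < 1) :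
    TermBound118 S W sp (Real.exp 1 * 9 * 64 * K₀ 64 8 ^ 2 * (c.C3act * c.ε₁)) r₁ :=
  termBound118_of_bound238_table F K S W Wk sp hW hrestr han
    (fun k => bound238_of_termwise226_config F K (S k) (Wk k) (sp (k + 1)) c hL hLc hN (T k) (hdom k) (h226 k)) hA hr₁ hrate hsmall

open Classical in
/-- **… AND [I] p. 263's ANALYTICITY ON THE SPACES** (`W1.TermAnalytic S W sp`) from the same data — §2 feeds file 10's `termAnalytic_of_bound238_table`.
[cite: Balaban1988RG2Cluster, p.15 (analyticity statement) and Lemma 3 (2.38) p.20; Balaban1987RG1, §1 p.263] -/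
theorem termAnalytic_of_termwise226_config (S : ClusterTower (F.P K) 𝔸 M) (W : Set (ℕ → ℝ)) (Wk : (k : ℕ) → Set (Fin (k + 1) → ℝ))
    (sp : (j : ℕ) → (domSys (F.P K) M j).Dom → Set (CPair (F.P K) 𝔸)) (c : B13.Consts) {L : ℕ} [NeZero L] (hL : 8 ≤ c.L)
    (hLc : c.L = L) {a a₂ a₂' a₅ Aabs : ℝ} (hN : Lemma3Numerics c M ((c.L : ℝ) / 2) a a₂ a₂' a₅ Aabs)
    (T : (k : ℕ) → (Fin (k + 1) → ℝ) → (Z : TDom 4 (domCount (F.P K) M (k + 1))) →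
      Finset (TDom 4 (L * domCount (F.P K) M (k + 1))) × Finset (TBond 4 M (L * domCount (F.P K) M (k + 1))) → CPair (F.P K) 𝔸 → ℂ)
    (hdom : ∀ k, ∀ g ∈ Wk k, ∀ (Z : (domSys (F.P K) M (k + 1)).Dom) (φ : CPair (F.P K) 𝔸), φ ∈ sp (k + 1) Z →
      ‖(S k).H g φ Z‖ ≤ ∑ t ∈ terms L M Z, ‖T k g Z t φ‖)
    (h226 : ∀ k, ∀ g ∈ Wk k, ∀ (Z : (domSys (F.P K) M (k + 1)).Dom) (φ : CPair (F.P K) 𝔸), φ ∈ sp (k + 1) Z → ∀ t ∈ terms L M Z,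
      ‖T k g Z t φ‖ ≤ weight L M c Z a t * Real.exp (a₅ * ((Z.1).card : ℝ)))
    (hW : ∀ k, ∀ g ∈ W, restrictPrefix k g ∈ Wk k) (hrestr : ∀ k, W1.SpRestr (sp (k + 1)))
    (han : ∀ k, (S k).AnalyticH (Wk k) (sp (k + 1))) {r₁ : ℝ} (hr₁ : 0 ≤ r₁) (hA : 0 ≤ c.C3act * c.ε₁)
    (hrate : r₁ + 2 * (64 * Real.log 162) + 2 ≤ (1 - 8 * c.δ) * ((c.L : ℝ) / 2) * c.κ)
    (hsmall : c.C3act * c.ε₁ * Real.exp (5 * r₁ + 1) * K₀ 64 8 * 9 * 64 < 1) :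
    TermAnalytic S W sp :=
  termAnalytic_of_bound238_table F K S W Wk sp hW hrestr han
    (fun k => bound238_of_termwise226_config F K (S k) (Wk k) (sp (k + 1)) c hL hLc hN (T k) (hdom k) (h226 k)) hA hr₁ hrate hsmall

open Classical in
/-- **L05 AT THE W1 READING FROM (2.26) PER TERM**: for a level pairing `R` of run length `k` and run A's tower `S` on `F.P k`, per-step termwise (2.26)
data + `AnalyticH` on a restriction-closed table holding the readings `R.embA U`, the numerics and the two clauses ⟹ `T4OutputRate.DecayBound (R.EA S)
(Window γ) (e·9·64·K₀(64,8)²·C₃ε₁) r₁` (window `]0, γ]`, `Wk k = box γ k`) — §2 feeds file 10's `decayBound_EA_of_bound238_table`.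
[cite: Balaban1988RG2Cluster, (2.26) p.17 and Lemma 3 (2.38) p.20; Balaban1987RG1, (0.25) p.257 and (1.18) p.263] -/
theorem decayBound_EA_of_termwise226_config {k : ℕ} (R : LevelPairing F 𝔸 M k) (S : ClusterTower (F.P k) 𝔸 M)
    (sp : (j : ℕ) → (domSys (F.P k) M j).Dom → Set (CPair (F.P k) 𝔸)) (c : B13.Consts) {L : ℕ} [NeZero L] (hL : 8 ≤ c.L)
    (hLc : c.L = L) {a a₂ a₂' a₅ Aabs : ℝ} (hN : Lemma3Numerics c M ((c.L : ℝ) / 2) a a₂ a₂' a₅ Aabs) {γ : ℝ}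
    (T : (m : ℕ) → (Fin (m + 1) → ℝ) → (Z : TDom 4 (domCount (F.P k) M (m + 1))) →
      Finset (TDom 4 (L * domCount (F.P k) M (m + 1))) × Finset (TBond 4 M (L * domCount (F.P k) M (m + 1))) → CPair (F.P k) 𝔸 → ℂ)
    (hdom : ∀ m, ∀ g ∈ box γ m, ∀ (Z : (domSys (F.P k) M (m + 1)).Dom) (φ : CPair (F.P k) 𝔸), φ ∈ sp (m + 1) Z →
      ‖(S m).H g φ Z‖ ≤ ∑ t ∈ terms L M Z, ‖T m g Z t φ‖)
    (h226 : ∀ m, ∀ g ∈ box γ m, ∀ (Z : (domSys (F.P k) M (m + 1)).Dom) (φ : CPair (F.P k) 𝔸), φ ∈ sp (m + 1) Z → ∀ t ∈ terms L M Z,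
      ‖T m g Z t φ‖ ≤ weight L M c Z a t * Real.exp (a₅ * ((Z.1).card : ℝ)))
    (hembA : ∀ (j : ℕ) (U : R.BgA) (X : (domSys (F.P k) M j).Dom), R.embA U ∈ sp j X)
    (hrestr : ∀ m, W1.SpRestr (sp (m + 1))) (han : ∀ m, (S m).AnalyticH (box γ m) (sp (m + 1))) {r₁ : ℝ} (hr₁ : 0 ≤ r₁)
    (hA : 0 ≤ c.C3act * c.ε₁) (hrate : r₁ + 2 * (64 * Real.log 162) + 2 ≤ (1 - 8 * c.δ) * ((c.L : ℝ) / 2) * c.κ)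
    (hsmall : c.C3act * c.ε₁ * Real.exp (5 * r₁ + 1) * K₀ 64 8 * 9 * 64 < 1) :
    DecayBound (R.EA S) (Window γ) (Real.exp 1 * 9 * 64 * K₀ 64 8 ^ 2 * (c.C3act * c.ε₁)) r₁ :=
  decayBound_EA_of_bound238_table R S sp hembA hrestr han
    (fun m => bound238_of_termwise226_config F k (S m) (box γ m) (sp (m + 1)) c hL hLc hN (T m) (hdom m) (h226 m)) hA hr₁ hrate hsmall

end Summit.QuantumFields.YangMills.BalabanUVNodes.N18HLayerW1Lemma3Config

end
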